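import Mathlib
import HarnessLib
import Summits.ResolutionOfSingularities.ResolutionOfSingularities.Theorems.WildQuotientsWildQuotientResolutionS1aGameFrameWF
import Summits.ResolutionOfSingularities.ResolutionOfSingularities.Theorems.WildQuotientsWildQuotientResolutionS1aEndGluing
import Summits.ResolutionOfSingularities.ResolutionOfSingularities.Theorems.WildQuotientsWildQuotientResolutionS1aBlowupNodeAtlas

/-!
# S1a — the KILL FRAME closed: `KillTameModel` from a well-founded strategy alone (`p` prime, `G = ⟨g₀⟩`)

[OURS · L1 W4.5c · lead-1 g6] — NOT a statement of the manuscript; counted 0; AI-level work, weaker than expert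
review. Crux stmt-ResolutionOfSingularities-17941 (`WildQuotients.CyclicQuotientFourfolds`), line `s1a-logminvertex`,
stub `stub_localGame`. With H4c discharged (`BlowupCharts.blowupNodeAtlas_of_prime`, this seat) and (G5) discharged
(`GameFrame.endGluing`, 033), the assembly `GameFrame.killTameModel_of_blowupNodeAtlas_wf` loses its two frame
hypotheses: **`killTameModel_of_strategyWF`** — for a prime `p`, a cyclic group `G = ⟨g₀⟩` acting on `X′` over a
separated base, ANY `G`-model `M₀` (e.g. `GModel.initial` from a node atlas on `X′`) and a well-founded STRATEGY
(`StrategyWF`: a measure into a well-founded order strictly decreasing along some admissible move from every non-terminal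
model) yield `KillTameModel q G ρ`. What remains of the kill branch of `stub_localGame` is exactly `StrategyWF` — the
termination crux (plan-1 STRATEGY-DESIGN v1.1: candidate `μ̂ = (ν₁, ν₃′, ν₂rev, ν₄) ∈ Lex (Fin 4 → ℕ)`) — and the initial
node atlas.
-/

set_option linter.dupNamespace false

noncomputable section

open CategoryTheory AlgebraicGeometry TopologicalSpace
open Literature.AlgebraicGeometry.Resolution Literature.AlgebraicGeometry.RelativeSpec
open Summit.ResolutionOfSingularities.ResolutionOfSingularities.Theorems.WildQuotientResolution.S1
open Summit.ResolutionOfSingularities.ResolutionOfSingularities.Theorems.WildQuotientResolution.S1.NodeAtlas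
open Summit.ResolutionOfSingularities.ResolutionOfSingularities.Theorems.WildQuotientResolution.S1.MoveStep
open Summit.ResolutionOfSingularities.ResolutionOfSingularities.Theorems.WildQuotientResolution.S1.BlowupCharts

namespace Summit.ResolutionOfSingularities.ResolutionOfSingularities.Theorems.WildQuotientResolution.S1.GameFrame

variable {p : ℕ} {X' X₁ : Scheme.{0}} {q : X' ⟶ X₁} {G : Type} [Group G] {ρ : G →* Aut X'} {g₀ : G}

/-- **THE KILL FRAME, closed**: `KillTameModel` from a well-founded strategy, for `p` prime and `G = ⟨g₀⟩`, starting
from any `G`-model. [OURS · L1 W4.5c] -/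
theorem killTameModel_of_strategyWF [Finite G] [X₁.IsSeparated] [IsSeparated q] (hp : p.Prime)
    (hG : ∀ g : G, g ∈ Subgroup.zpowers g₀) (hstrat : StrategyWF p q G ρ g₀) (M₀ : GModel p q G ρ g₀) :
    KillTameModel q G ρ :=
  killTameModel_of_blowupNodeAtlas_wf hG (blowupNodeAtlas_of_prime hp) endGluing hstrat M₀

/-- **… from the initial model**: a node atlas on `X′` itself and a well-founded strategy give `KillTameModel`.
[OURS · L1 W4.5c] -/
theorem killTameModel_of_nodeAtlas_of_strategyWF [Finite G] [X₁.IsSeparated] [IsSeparated q] [IsIntegral X']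
    [IsLocallyNoetherian X'] (hp : p.Prime) (hG : ∀ g : G, g ∈ Subgroup.zpowers g₀)
    (hq : ∀ g : G, (ρ g).hom ≫ q = q) (hatlas : NodeAtlas p (⟨ρ, hq⟩ : ActionOver q G) g₀)
    (hstrat : StrategyWF p q G ρ g₀) : KillTameModel q G ρ :=
  killTameModel_of_strategyWF hp hG hstrat (GModel.initial hq hatlas)

/-- The ℕ-valued form (H4e `Strategy`). -/
theorem killTameModel_of_nodeAtlas_of_strategy [Finite G] [X₁.IsSeparated] [IsSeparated q] [IsIntegral X']
    [IsLocallyNoetherian X'] (hp : p.Prime) (hG : ∀ g : G, g ∈ Subgroup.zpowers g₀)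
    (hq : ∀ g : G, (ρ g).hom ≫ q = q) (hatlas : NodeAtlas p (⟨ρ, hq⟩ : ActionOver q G) g₀)
    (hstrat : Strategy p q G ρ g₀) : KillTameModel q G ρ :=
  killTameModel_of_nodeAtlas_of_strategyWF hp hG hq hatlas (strategyWF_of_strategy hstrat)

end Summit.ResolutionOfSingularities.ResolutionOfSingularities.Theorems.WildQuotientResolution.S1.GameFrame

end
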